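import Summits.Ventures.CertifiedArithmetic.LowPrec.GemmFirstRegimeRows
import Summits.Ventures.CertifiedArithmetic.LowPrec.GemmWorstCaseMixAPrec
import Summits.Ventures.CertifiedArithmetic.LowPrec.GemmWorstCaseMixBPrec
import Summits.Ventures.CertifiedArithmetic.LowPrec.GemmWorstCaseMixCPrec
import HarnessLib

/-!
# GEMM worst case LXII-d — ROWS of `W_p(n)` in the first regime: the mixed MX alphabets
# E2M3·E2M1, E3M2·E2M1, E3M2·E2M3 (every precision; binary32 in integers)

HONEST FRAMING: certified error envelopes and provably optimal rounding/accumulation schemes for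
low-precision formats under stated cost models; every table by two implementations; no hardware or
vendor claims.

The row engine of file LXII-c (`gridW_eq_zero`, `gridW_le_firstRegime`, `le_gridW_entry`,
`le_gridW_late`, `gridW_firstRegime`; `le_gridW_plateau` applies verbatim) for the three mixed
alphabets of [RouhaniEtAl2023MX, Table 1] (`W = worstRelErrMixA/B/C` of files LVI–LVIII, letters
`Λ(L)/2^G` of the θ-law data), under exactly the hypotheses of `worst4P/5P/7P_sandwich`:

* E2M3·E2M1 (`2^-4`, `720`, `45`); binary32: `W_24(n) = 0` iff `n ≤ 23302`; for `1 ≤ k ≤ 2^23`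
  `max(k/(2^24+4+k), (k-1)/(2^24+k-1)) ≤ W_24(23302+k) ≤ k/(2^24+k)` — the law is bracketed, NOT
  claimed: `2^24+1, 2^24+3` are not sums of `23303` letters (C2, `entry_p24.json`, two
  implementations); first entry `480 + 720·23301 + 21 = 2^24 + 5`, late entry `… + 16 = 2^24`.
* E3M2·E2M1 (`2^-5`, `5376`, `21`); binary32: `W_24(n) = 0` iff `n ≤ 3121`;
  `max(k/(2^24+512+k), (k-1)/(2^24+k-1)) ≤ W_24(3121+k) ≤ k/(2^24+k)` (first entry
  `4608 + 5376·3120 + 1 = 2^24 + 513`; late entry `4096 + 5376·3120 = 2^24`).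
* E3M2·E2M3 (`2^-7`, `26880`, `105`); binary32: `W_24(n) = 0` iff `n ≤ 625` and
  `W_24(625+k) = k/(2^24+k)` for `1 ≤ k ≤ 2^23` (entry word `4096, 26880, 26880^{×623}, 1`).
Second implementation: `code/gemm/firstregime/` (C2).  References: [BoldoEtAl2023, Thm 4.5],
[LangeRump2019], [Higham2002, §4.2], [RouhaniEtAl2023MX, Table 1], [IEEE7542019, §4.3.1]. -/

namespace Summit.Ventures.CertifiedArithmetic.LowPrec.Gemm

open Literature.ComputerArithmetic.FloatingPoint
open Literature.ComputerArithmetic.FloatingPoint.MiniFloat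
open Literature.ComputerArithmetic.FloatingPoint.MiniFloat.ThetaLaw
open Finset

/-! ### E2M3·E2M1: grid `2^-4`, `M = 720`, `m₀ = 45` -/

/-- Letter facts of `Λ(E2M3·E2M1)` (165 letters): modulus `≤ 720`, odd ones `≤ 45`. [cell, kernel] -/
theorem lamMixA_facts :
    ∀ z ∈ e2m3e2m1Law.lam, z.natAbs ≤ 720 ∧ (z % 2 = 0 ∨ z.natAbs ≤ 45) := by decide +kernel

/-- … on values: every letter of `Λ(E2M3·E2M1)/2^4` is a grid letter of `(4, 720, 45)`. [cell] -/
theorem piMixA_grid : ∀ q, e2m3e2m1Law.PiL 4 q →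
    ∃ z : ℤ, q = (z : ℚ) / 2 ^ 4 ∧ z.natAbs ≤ 720 ∧ (z % 2 = 0 ∨ z.natAbs ≤ 45) :=
  fun _ ⟨z, hz, hq⟩ => ⟨z, hq, lamMixA_facts z hz⟩

/-- A natural letter by its index fact. [cell] -/
theorem piMixA_nat {A : ℕ} (hA : (A : ℤ) ∈ e2m3e2m1Law.lam) :
    e2m3e2m1Law.PiL 4 (((A : ℕ) : ℚ) / 2 ^ 4) :=
  ⟨(A : ℤ), hA, by simp⟩

/-- The unit letter `2^-4`. [cell] -/
theorem piMixA_one : e2m3e2m1Law.PiL 4 (1 / 2 ^ 4) := ⟨1, by decide, by simp⟩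

/-- `W_φ` of E2M3·E2M1 is the attained maximum over words of the alphabet. [cell] -/
theorem worst4P_spec (φ : Format) :
    (∀ x : ℕ → ℚ, (∀ j, e2m3e2m1Law.PiL 4 (x j)) → ∀ m, relErr φ x m ≤ worstRelErrMixA φ m) ∧
    (∀ m, ∃ x : ℕ → ℚ, (∀ j, e2m3e2m1Law.PiL 4 (x j)) ∧ worstRelErrMixA φ m = relErr φ x m) := by
  refine ⟨fun x hx m => relErr_le_worst4P φ x hx m, fun m => ?_⟩
  obtain ⟨w, -, hw⟩ := exists_mem_eq_sup'
    (univ_nonempty : (univ : Finset (Fin (m + 1) → Fin 165)).Nonempty)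
    (fun w => relErr φ (wordInputMixA w) m)
  exact ⟨wordInputMixA w, wordInputMixA_mem w, hw⟩

section MixA

variable {φ : Format} (hm : 9 ≤ φ.manBits) (hq : φ.qexp ≤ -4)
  (hR : (2 : ℚ) ^ (φ.manBits + 12) ≤ φ.maxRat)
include hm hq hR

omit hq hR in
/-- `M = 720 ≤ T` iff `p ≥ 10`. [cell] -/
theorem mixA_MT : 720 ≤ 2 ^ (φ.manBits + 1) :=
  le_trans (by norm_num) (Nat.pow_le_pow_right (by norm_num) (by omega : 10 ≤ φ.manBits + 1))

/-- (i) E2M3·E2M1, every `p ≥ 10`: `W_φ(m+1) = 0` whenever `720 m + 45 < 2^p`. [cell] -/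
theorem worst4P_eq_zero {m : ℕ} (h : 720 * m + 45 < 2 ^ (φ.manBits + 1)) : worstRelErrMixA φ m = 0 :=
  gridW_eq_zero piMixA_grid (worst4P_spec φ).2 hq (E := 9) hR (by norm_num) (mixA_MT hm) h

/-- (ii) E2M3·E2M1, `p ≥ 10`: `W_φ(j₀+1+k) ≤ k/(2^p+k)` (`k ≤ 2^(p-1)`, `720 j₀ + 45 < 2^p`). [cell] -/
theorem worst4P_le_firstRegime {j0 : ℕ} (hj0 : 720 * j0 + 45 < 2 ^ (φ.manBits + 1)) {k : ℕ}
    (hk : k ≤ 2 ^ φ.manBits) : worstRelErrMixA φ (j0 + k) ≤ (k : ℚ) / (2 ^ (φ.manBits + 1) + k) :=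
  gridW_le_firstRegime piMixA_grid (worst4P_spec φ).2 hq (E := 9) hR (by norm_num) (mixA_MT hm)
    (by norm_num) (by norm_num) hj0 hk

/-- (iv-a) E2M3·E2M1: the entry row from letters `A + B + 720 j + C = 2^p + 4e + 1`. [cell] -/
theorem le_worst4P_entry {j A B C e : ℕ} (hA : (A : ℤ) ∈ e2m3e2m1Law.lam)
    (hB : (B : ℤ) ∈ e2m3e2m1Law.lam) (hC : (C : ℤ) ∈ e2m3e2m1Law.lam)
    (hj : 720 * (j + 1) + 45 < 2 ^ (φ.manBits + 1))
    (he : 4 * e < 2 ^ (φ.manBits + 1)) (hsum : A + B + 720 * j + C = 2 ^ (φ.manBits + 1) + 4 * e + 1)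
    (d : ℕ) :
    ((d + 1 : ℕ) : ℚ) / (2 ^ (φ.manBits + 1) + 4 * e + ((d + 1 : ℕ) : ℚ))
      ≤ worstRelErrMixA φ (j + 2 + d) :=
  le_gridW_entry piMixA_grid (worst4P_spec φ).1 hq (E := 9) hR (by norm_num) (mixA_MT hm)
    (by norm_num) (by norm_num) (piMixA_nat hA) (piMixA_nat hB) (piMixA_nat hC)
    (piMixA_nat (A := 720) (by decide)) piMixA_one hj he hsum d

/-- (iv-b) E2M3·E2M1: the late row from letters `A + B + 720 j + C = 2^p`. [cell] -/
theorem le_worst4P_late {j A B C : ℕ} (hA : (A : ℤ) ∈ e2m3e2m1Law.lam)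
    (hB : (B : ℤ) ∈ e2m3e2m1Law.lam) (hC : (C : ℤ) ∈ e2m3e2m1Law.lam)
    (hj : 720 * (j + 1) + 45 < 2 ^ (φ.manBits + 1))
    (hsum : A + B + 720 * j + C = 2 ^ (φ.manBits + 1)) (d : ℕ) :
    (d : ℚ) / (2 ^ (φ.manBits + 1) + d) ≤ worstRelErrMixA φ (j + 2 + d) :=
  le_gridW_late piMixA_grid (worst4P_spec φ).1 hq (E := 9) hR (by norm_num) (mixA_MT hm)
    (by norm_num) (by norm_num) (piMixA_nat hA) (piMixA_nat hB) (piMixA_nat hC)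
    (piMixA_nat (A := 720) (by decide)) piMixA_one hj hsum d

/-- (iii) E2M3·E2M1, every `p ≥ 10` in which letters spell `A + B + 720 j + C = 2^p + 1`:
`W_φ(j+2+k) = k/(2^p+k)` for `1 ≤ k ≤ 2^(p-1)`. [cell; cite: BoldoEtAl2023, Thm 4.5] -/
theorem worst4P_firstRegime {j A B C : ℕ} (hA : (A : ℤ) ∈ e2m3e2m1Law.lam)
    (hB : (B : ℤ) ∈ e2m3e2m1Law.lam) (hC : (C : ℤ) ∈ e2m3e2m1Law.lam)
    (hj : 720 * (j + 1) + 45 < 2 ^ (φ.manBits + 1))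
    (hsum : A + B + 720 * j + C = 2 ^ (φ.manBits + 1) + 1) {k : ℕ} (hk : 1 ≤ k)
    (hk' : k ≤ 2 ^ φ.manBits) :
    worstRelErrMixA φ (j + 1 + k) = (k : ℚ) / (2 ^ (φ.manBits + 1) + k) :=
  gridW_firstRegime piMixA_grid (worst4P_spec φ).1 (worst4P_spec φ).2 hq (E := 9) hR
    (by norm_num) (mixA_MT hm) (by norm_num) (by norm_num) (by norm_num) (piMixA_nat hA)
    (piMixA_nat hB) (piMixA_nat hC) (piMixA_nat (A := 720) (by decide)) piMixA_one hj hsum hk hk'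

end MixA

/-- E2M3·E2M1 INTO binary32 (`p = 24`): `W_24(n) = 0` for `n ≤ 23302 = n₀`
(`720·23301 + 45 < 2^24`). [cell, gemm.tex Prop. p:fpA; C2 cross-check certs/gemm/firstregime/] -/
theorem worst4P_Binary32_eq_zero {m : ℕ} (hm : m ≤ 23301) : worstRelErrMixA Format.Binary32 m = 0 := by
  obtain ⟨h1, h2, h3, h4⟩ := Binary32_hyps4
  have hT : 2 ^ (Format.Binary32.manBits + 1) = 16777216 := by rw [pow_succ, h4]; norm_num
  exact worst4P_eq_zero h1 h2 h3 (by omega)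

/-- E2M3·E2M1 INTO binary32, upper row: `W_24(23302 + k) ≤ k/(2^24 + k)`, `k ≤ 2^23`. [cell] -/
theorem worst4P_Binary32_le {k : ℕ} (hk : k ≤ 2 ^ 23) :
    worstRelErrMixA Format.Binary32 (23301 + k) ≤ (k : ℚ) / (2 ^ 24 + k) := by
  obtain ⟨h1, h2, h3, h4⟩ := Binary32_hyps4
  have hT : 2 ^ (Format.Binary32.manBits + 1) = 16777216 := by rw [pow_succ, h4]; norm_num
  have hk' : k ≤ 2 ^ Format.Binary32.manBits := hk
  have h := worst4P_le_firstRegime h1 h2 h3 (j0 := 23301) (by omega) hk'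
  rwa [show Format.Binary32.manBits + 1 = 24 from rfl] at h

/-- E2M3·E2M1 INTO binary32, deficient entry row: `k/(2^24 + 4 + k) ≤ W_24(23302 + k)` for every
`k ≥ 1`, from `480, 720^{×23301}, 21, 1^{×(k-1)}` (`480 + 720·23301 + 21 = 2^24 + 5`; `2^24 + 1` and
`2^24 + 3` are not sums of `23303` letters — C2, two implementations — so the law row is NOT
claimed for this alphabet at `p = 24`). [cell, gemm.tex Prop. p:fpA (iv)] -/
theorem worst4P_Binary32_entry (d : ℕ) :
    ((d + 1 : ℕ) : ℚ) / (2 ^ 24 + 4 + ((d + 1 : ℕ) : ℚ))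
      ≤ worstRelErrMixA Format.Binary32 (23302 + d) := by
  obtain ⟨h1, h2, h3, h4⟩ := Binary32_hyps4
  have hT : 2 ^ (Format.Binary32.manBits + 1) = 16777216 := by rw [pow_succ, h4]; norm_num
  have h := le_worst4P_entry h1 h2 h3 (j := 23300) (A := 480) (B := 720) (C := 21) (e := 1)
    (by decide) (by decide) (by decide) (by omega) (by omega) (by omega) d
  rw [show 23300 + 2 + d = 23302 + d by ring, show Format.Binary32.manBits + 1 = 24 from rfl] at h
  simpa using h

/-- E2M3·E2M1 INTO binary32, late entry row: `d/(2^24 + d) ≤ W_24(23303 + d)`, from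
`480, 720^{×23301}, 16, 1^{×d}` (`480 + 720·23301 + 16 = 2^24`). [cell, gemm.tex Prop. p:fpA (iv)] -/
theorem worst4P_Binary32_late (d : ℕ) :
    (d : ℚ) / (2 ^ 24 + d) ≤ worstRelErrMixA Format.Binary32 (23302 + d) := by
  obtain ⟨h1, h2, h3, h4⟩ := Binary32_hyps4
  have hT : 2 ^ (Format.Binary32.manBits + 1) = 16777216 := by rw [pow_succ, h4]; norm_num
  have h := le_worst4P_late h1 h2 h3 (j := 23300) (A := 480) (B := 720) (C := 16)
    (by decide) (by decide) (by decide) (by omega) (by omega) d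
  rwa [show 23300 + 2 + d = 23302 + d by ring, show Format.Binary32.manBits + 1 = 24 from rfl] at h

/-! ### E3M2·E2M1: grid `2^-5`, `M = 5376`, `m₀ = 21` -/

/-- Letter facts of `Λ(E3M2·E2M1)` (143 letters): modulus `≤ 5376`, odd ones `≤ 21`. [cell, kernel] -/
theorem lamMixB_facts :
    ∀ z ∈ e3m2e2m1Law.lam, z.natAbs ≤ 5376 ∧ (z % 2 = 0 ∨ z.natAbs ≤ 21) := by decide +kernel

/-- … on values: every letter of `Λ(E3M2·E2M1)/2^5` is a grid letter of `(5, 5376, 21)`. [cell] -/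
theorem piMixB_grid : ∀ q, e3m2e2m1Law.PiL 5 q →
    ∃ z : ℤ, q = (z : ℚ) / 2 ^ 5 ∧ z.natAbs ≤ 5376 ∧ (z % 2 = 0 ∨ z.natAbs ≤ 21) :=
  fun _ ⟨z, hz, hq⟩ => ⟨z, hq, lamMixB_facts z hz⟩

/-- A natural letter by its index fact. [cell] -/
theorem piMixB_nat {A : ℕ} (hA : (A : ℤ) ∈ e3m2e2m1Law.lam) :
    e3m2e2m1Law.PiL 5 (((A : ℕ) : ℚ) / 2 ^ 5) :=
  ⟨(A : ℤ), hA, by simp⟩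

/-- The unit letter `2^-5`. [cell] -/
theorem piMixB_one : e3m2e2m1Law.PiL 5 (1 / 2 ^ 5) := ⟨1, by decide, by simp⟩

/-- `W_φ` of E3M2·E2M1 is the attained maximum over words of the alphabet. [cell] -/
theorem worst5P_spec (φ : Format) :
    (∀ x : ℕ → ℚ, (∀ j, e3m2e2m1Law.PiL 5 (x j)) → ∀ m, relErr φ x m ≤ worstRelErrMixB φ m) ∧
    (∀ m, ∃ x : ℕ → ℚ, (∀ j, e3m2e2m1Law.PiL 5 (x j)) ∧ worstRelErrMixB φ m = relErr φ x m) := by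
  refine ⟨fun x hx m => relErr_le_worst5P φ x hx m, fun m => ?_⟩
  obtain ⟨w, -, hw⟩ := exists_mem_eq_sup'
    (univ_nonempty : (univ : Finset (Fin (m + 1) → Fin 143)).Nonempty)
    (fun w => relErr φ (wordInputMixB w) m)
  exact ⟨wordInputMixB w, wordInputMixB_mem w, hw⟩

section MixB

variable {φ : Format} (hm : 12 ≤ φ.manBits) (hq : φ.qexp ≤ -5)
  (hR : (2 : ℚ) ^ (φ.manBits + 15) ≤ φ.maxRat)
include hm hq hR

omit hq hR in
/-- `M = 5376 ≤ T` iff `p ≥ 13`. [cell] -/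
theorem mixB_MT : 5376 ≤ 2 ^ (φ.manBits + 1) :=
  le_trans (by norm_num) (Nat.pow_le_pow_right (by norm_num) (by omega : 13 ≤ φ.manBits + 1))

/-- (i) E3M2·E2M1, every `p ≥ 13`: `W_φ(m+1) = 0` whenever `5376 m + 21 < 2^p`. [cell] -/
theorem worst5P_eq_zero {m : ℕ} (h : 5376 * m + 21 < 2 ^ (φ.manBits + 1)) : worstRelErrMixB φ m = 0 :=
  gridW_eq_zero piMixB_grid (worst5P_spec φ).2 hq (E := 12) hR (by norm_num) (mixB_MT hm) h

/-- (ii) E3M2·E2M1, `p ≥ 13`: `W_φ(j₀+1+k) ≤ k/(2^p+k)` (`k ≤ 2^(p-1)`, `5376 j₀ + 21 < 2^p`). [cell] -/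
theorem worst5P_le_firstRegime {j0 : ℕ} (hj0 : 5376 * j0 + 21 < 2 ^ (φ.manBits + 1)) {k : ℕ}
    (hk : k ≤ 2 ^ φ.manBits) : worstRelErrMixB φ (j0 + k) ≤ (k : ℚ) / (2 ^ (φ.manBits + 1) + k) :=
  gridW_le_firstRegime piMixB_grid (worst5P_spec φ).2 hq (E := 12) hR (by norm_num) (mixB_MT hm)
    (by norm_num) (by norm_num) hj0 hk

/-- (iv-a) E3M2·E2M1: the entry row from letters `A + B + 5376 j + C = 2^p + 4e + 1`. [cell] -/
theorem le_worst5P_entry {j A B C e : ℕ} (hA : (A : ℤ) ∈ e3m2e2m1Law.lam)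
    (hB : (B : ℤ) ∈ e3m2e2m1Law.lam) (hC : (C : ℤ) ∈ e3m2e2m1Law.lam)
    (hj : 5376 * (j + 1) + 21 < 2 ^ (φ.manBits + 1))
    (he : 4 * e < 2 ^ (φ.manBits + 1)) (hsum : A + B + 5376 * j + C = 2 ^ (φ.manBits + 1) + 4 * e + 1)
    (d : ℕ) :
    ((d + 1 : ℕ) : ℚ) / (2 ^ (φ.manBits + 1) + 4 * e + ((d + 1 : ℕ) : ℚ))
      ≤ worstRelErrMixB φ (j + 2 + d) :=
  le_gridW_entry piMixB_grid (worst5P_spec φ).1 hq (E := 12) hR (by norm_num) (mixB_MT hm)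
    (by norm_num) (by norm_num) (piMixB_nat hA) (piMixB_nat hB) (piMixB_nat hC)
    (piMixB_nat (A := 5376) (by decide)) piMixB_one hj he hsum d

/-- (iv-b) E3M2·E2M1: the late row from letters `A + B + 5376 j + C = 2^p`. [cell] -/
theorem le_worst5P_late {j A B C : ℕ} (hA : (A : ℤ) ∈ e3m2e2m1Law.lam)
    (hB : (B : ℤ) ∈ e3m2e2m1Law.lam) (hC : (C : ℤ) ∈ e3m2e2m1Law.lam)
    (hj : 5376 * (j + 1) + 21 < 2 ^ (φ.manBits + 1))
    (hsum : A + B + 5376 * j + C = 2 ^ (φ.manBits + 1)) (d : ℕ) :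
    (d : ℚ) / (2 ^ (φ.manBits + 1) + d) ≤ worstRelErrMixB φ (j + 2 + d) :=
  le_gridW_late piMixB_grid (worst5P_spec φ).1 hq (E := 12) hR (by norm_num) (mixB_MT hm)
    (by norm_num) (by norm_num) (piMixB_nat hA) (piMixB_nat hB) (piMixB_nat hC)
    (piMixB_nat (A := 5376) (by decide)) piMixB_one hj hsum d

/-- (iii) E3M2·E2M1, every `p ≥ 13` in which letters spell `A + B + 5376 j + C = 2^p + 1`:
`W_φ(j+2+k) = k/(2^p+k)` for `1 ≤ k ≤ 2^(p-1)`. [cell; cite: BoldoEtAl2023, Thm 4.5] -/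
theorem worst5P_firstRegime {j A B C : ℕ} (hA : (A : ℤ) ∈ e3m2e2m1Law.lam)
    (hB : (B : ℤ) ∈ e3m2e2m1Law.lam) (hC : (C : ℤ) ∈ e3m2e2m1Law.lam)
    (hj : 5376 * (j + 1) + 21 < 2 ^ (φ.manBits + 1))
    (hsum : A + B + 5376 * j + C = 2 ^ (φ.manBits + 1) + 1) {k : ℕ} (hk : 1 ≤ k)
    (hk' : k ≤ 2 ^ φ.manBits) :
    worstRelErrMixB φ (j + 1 + k) = (k : ℚ) / (2 ^ (φ.manBits + 1) + k) :=
  gridW_firstRegime piMixB_grid (worst5P_spec φ).1 (worst5P_spec φ).2 hq (E := 12) hR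
    (by norm_num) (mixB_MT hm) (by norm_num) (by norm_num) (by norm_num) (piMixB_nat hA)
    (piMixB_nat hB) (piMixB_nat hC) (piMixB_nat (A := 5376) (by decide)) piMixB_one hj hsum hk hk'

end MixB

/-- E3M2·E2M1 INTO binary32 (`p = 24`): `W_24(n) = 0` for `n ≤ 3121 = n₀`
(`5376·3120 + 21 < 2^24`). [cell, gemm.tex Prop. p:fpA; C2 cross-check certs/gemm/firstregime/] -/
theorem worst5P_Binary32_eq_zero {m : ℕ} (hm : m ≤ 3120) : worstRelErrMixB Format.Binary32 m = 0 := by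
  obtain ⟨h1, h2, h3, h4⟩ := Binary32_hyps5
  have hT : 2 ^ (Format.Binary32.manBits + 1) = 16777216 := by rw [pow_succ, h4]; norm_num
  exact worst5P_eq_zero h1 h2 h3 (by omega)

/-- E3M2·E2M1 INTO binary32, upper row: `W_24(3121 + k) ≤ k/(2^24 + k)`, `k ≤ 2^23`. [cell] -/
theorem worst5P_Binary32_le {k : ℕ} (hk : k ≤ 2 ^ 23) :
    worstRelErrMixB Format.Binary32 (3120 + k) ≤ (k : ℚ) / (2 ^ 24 + k) := by
  obtain ⟨h1, h2, h3, h4⟩ := Binary32_hyps5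
  have hT : 2 ^ (Format.Binary32.manBits + 1) = 16777216 := by rw [pow_succ, h4]; norm_num
  have hk' : k ≤ 2 ^ Format.Binary32.manBits := hk
  have h := worst5P_le_firstRegime h1 h2 h3 (j0 := 3120) (by omega) hk'
  rwa [show Format.Binary32.manBits + 1 = 24 from rfl] at h

/-- E3M2·E2M1 INTO binary32, deficient entry row: `k/(2^24 + 512 + k) ≤ W_24(3121 + k)` for every
`k ≥ 1`, from `4608, 5376^{×3120}, 1, 1^{×(k-1)}` (`4608 + 5376·3120 + 1 = 2^24 + 513`, `e = 128`;
no odd sum of `3122` letters lies in `[2^24 + 1, 2^24 + 511]` — C2, two implementations — so the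
law row is NOT claimed for this alphabet at `p = 24`). [cell, gemm.tex Prop. p:fpA (iv)] -/
theorem worst5P_Binary32_entry (d : ℕ) :
    ((d + 1 : ℕ) : ℚ) / (2 ^ 24 + 512 + ((d + 1 : ℕ) : ℚ))
      ≤ worstRelErrMixB Format.Binary32 (3121 + d) := by
  obtain ⟨h1, h2, h3, h4⟩ := Binary32_hyps5
  have hT : 2 ^ (Format.Binary32.manBits + 1) = 16777216 := by rw [pow_succ, h4]; norm_num
  have h := le_worst5P_entry h1 h2 h3 (j := 3119) (A := 4608) (B := 5376) (C := 1) (e := 128)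
    (by decide) (by decide) (by decide) (by omega) (by omega) (by omega) d
  rw [show 3119 + 2 + d = 3121 + d by ring, show Format.Binary32.manBits + 1 = 24 from rfl] at h
  norm_num at h ⊢
  exact h

/-- E3M2·E2M1 INTO binary32, late entry row: `d/(2^24 + d) ≤ W_24(3122 + d)`, from
`2048, 5376, 5376^{×3119}, 2048, 1^{×d}` (`4096 + 5376·3120 = 2^24`).
[cell, gemm.tex Prop. p:fpA (iv)] -/
theorem worst5P_Binary32_late (d : ℕ) :
    (d : ℚ) / (2 ^ 24 + d) ≤ worstRelErrMixB Format.Binary32 (3121 + d) := by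
  obtain ⟨h1, h2, h3, h4⟩ := Binary32_hyps5
  have hT : 2 ^ (Format.Binary32.manBits + 1) = 16777216 := by rw [pow_succ, h4]; norm_num
  have h := le_worst5P_late h1 h2 h3 (j := 3119) (A := 2048) (B := 5376) (C := 2048)
    (by decide) (by decide) (by decide) (by omega) (by omega) d
  rwa [show 3119 + 2 + d = 3121 + d by ring, show Format.Binary32.manBits + 1 = 24 from rfl] at h

/-! ### E3M2·E2M3: grid `2^-7`, `M = 26880`, `m₀ = 105` -/

/-- Letter facts of `Λ(E3M2·E2M3)` (481 letters): modulus `≤ 26880`, odd ones `≤ 105`. [cell, kernel] -/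
theorem lamMixC_facts :
    ∀ z ∈ e3m2e2m3Law.lam, z.natAbs ≤ 26880 ∧ (z % 2 = 0 ∨ z.natAbs ≤ 105) := by decide +kernel

/-- … on values: every letter of `Λ(E3M2·E2M3)/2^7` is a grid letter of `(7, 26880, 105)`. [cell] -/
theorem piMixC_grid : ∀ q, e3m2e2m3Law.PiL 7 q →
    ∃ z : ℤ, q = (z : ℚ) / 2 ^ 7 ∧ z.natAbs ≤ 26880 ∧ (z % 2 = 0 ∨ z.natAbs ≤ 105) :=
  fun _ ⟨z, hz, hq⟩ => ⟨z, hq, lamMixC_facts z hz⟩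

/-- A natural letter by its index fact. [cell] -/
theorem piMixC_nat {A : ℕ} (hA : (A : ℤ) ∈ e3m2e2m3Law.lam) :
    e3m2e2m3Law.PiL 7 (((A : ℕ) : ℚ) / 2 ^ 7) :=
  ⟨(A : ℤ), hA, by simp⟩

/-- The unit letter `2^-7`. [cell] -/
theorem piMixC_one : e3m2e2m3Law.PiL 7 (1 / 2 ^ 7) := ⟨1, by decide, by simp⟩

/-- `W_φ` of E3M2·E2M3 is the attained maximum over words of the alphabet. [cell] -/
theorem worst7P_spec (φ : Format) :
    (∀ x : ℕ → ℚ, (∀ j, e3m2e2m3Law.PiL 7 (x j)) → ∀ m, relErr φ x m ≤ worstRelErrMixC φ m) ∧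
    (∀ m, ∃ x : ℕ → ℚ, (∀ j, e3m2e2m3Law.PiL 7 (x j)) ∧ worstRelErrMixC φ m = relErr φ x m) := by
  refine ⟨fun x hx m => relErr_le_worst7P φ x hx m, fun m => ?_⟩
  obtain ⟨w, -, hw⟩ := exists_mem_eq_sup'
    (univ_nonempty : (univ : Finset (Fin (m + 1) → Fin 481)).Nonempty)
    (fun w => relErr φ (wordInputMixC w) m)
  exact ⟨wordInputMixC w, wordInputMixC_mem w, hw⟩

section MixC

variable {φ : Format} (hm : 14 ≤ φ.manBits) (hq : φ.qexp ≤ -7)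
  (hR : (2 : ℚ) ^ (φ.manBits + 17) ≤ φ.maxRat)
include hm hq hR

omit hq hR in
/-- `M = 26880 ≤ T` iff `p ≥ 15`. [cell] -/
theorem mixC_MT : 26880 ≤ 2 ^ (φ.manBits + 1) :=
  le_trans (by norm_num) (Nat.pow_le_pow_right (by norm_num) (by omega : 15 ≤ φ.manBits + 1))

/-- (i) E3M2·E2M3, every `p ≥ 15`: `W_φ(m+1) = 0` whenever `26880 m + 105 < 2^p`. [cell] -/
theorem worst7P_eq_zero {m : ℕ} (h : 26880 * m + 105 < 2 ^ (φ.manBits + 1)) : worstRelErrMixC φ m = 0 :=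
  gridW_eq_zero piMixC_grid (worst7P_spec φ).2 hq (E := 14) hR (by norm_num) (mixC_MT hm) h

/-- (ii) E3M2·E2M3, `p ≥ 15`: `W_φ(j₀+1+k) ≤ k/(2^p+k)` (`k ≤ 2^(p-1)`, `26880 j₀ + 105 < 2^p`). [cell] -/
theorem worst7P_le_firstRegime {j0 : ℕ} (hj0 : 26880 * j0 + 105 < 2 ^ (φ.manBits + 1)) {k : ℕ}
    (hk : k ≤ 2 ^ φ.manBits) : worstRelErrMixC φ (j0 + k) ≤ (k : ℚ) / (2 ^ (φ.manBits + 1) + k) :=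
  gridW_le_firstRegime piMixC_grid (worst7P_spec φ).2 hq (E := 14) hR (by norm_num) (mixC_MT hm)
    (by norm_num) (by norm_num) hj0 hk

/-- (iv-a) E3M2·E2M3: the entry row from letters `A + B + 26880 j + C = 2^p + 4e + 1`. [cell] -/
theorem le_worst7P_entry {j A B C e : ℕ} (hA : (A : ℤ) ∈ e3m2e2m3Law.lam)
    (hB : (B : ℤ) ∈ e3m2e2m3Law.lam) (hC : (C : ℤ) ∈ e3m2e2m3Law.lam)
    (hj : 26880 * (j + 1) + 105 < 2 ^ (φ.manBits + 1))
    (he : 4 * e < 2 ^ (φ.manBits + 1)) (hsum : A + B + 26880 * j + C = 2 ^ (φ.manBits + 1) + 4 * e + 1)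
    (d : ℕ) :
    ((d + 1 : ℕ) : ℚ) / (2 ^ (φ.manBits + 1) + 4 * e + ((d + 1 : ℕ) : ℚ))
      ≤ worstRelErrMixC φ (j + 2 + d) :=
  le_gridW_entry piMixC_grid (worst7P_spec φ).1 hq (E := 14) hR (by norm_num) (mixC_MT hm)
    (by norm_num) (by norm_num) (piMixC_nat hA) (piMixC_nat hB) (piMixC_nat hC)
    (piMixC_nat (A := 26880) (by decide)) piMixC_one hj he hsum d

/-- (iv-b) E3M2·E2M3: the late row from letters `A + B + 26880 j + C = 2^p`. [cell] -/
theorem le_worst7P_late {j A B C : ℕ} (hA : (A : ℤ) ∈ e3m2e2m3Law.lam)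
    (hB : (B : ℤ) ∈ e3m2e2m3Law.lam) (hC : (C : ℤ) ∈ e3m2e2m3Law.lam)
    (hj : 26880 * (j + 1) + 105 < 2 ^ (φ.manBits + 1))
    (hsum : A + B + 26880 * j + C = 2 ^ (φ.manBits + 1)) (d : ℕ) :
    (d : ℚ) / (2 ^ (φ.manBits + 1) + d) ≤ worstRelErrMixC φ (j + 2 + d) :=
  le_gridW_late piMixC_grid (worst7P_spec φ).1 hq (E := 14) hR (by norm_num) (mixC_MT hm)
    (by norm_num) (by norm_num) (piMixC_nat hA) (piMixC_nat hB) (piMixC_nat hC)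
    (piMixC_nat (A := 26880) (by decide)) piMixC_one hj hsum d

/-- (iii) E3M2·E2M3, every `p ≥ 15` in which letters spell `A + B + 26880 j + C = 2^p + 1`:
`W_φ(j+2+k) = k/(2^p+k)` for `1 ≤ k ≤ 2^(p-1)`. [cell; cite: BoldoEtAl2023, Thm 4.5] -/
theorem worst7P_firstRegime {j A B C : ℕ} (hA : (A : ℤ) ∈ e3m2e2m3Law.lam)
    (hB : (B : ℤ) ∈ e3m2e2m3Law.lam) (hC : (C : ℤ) ∈ e3m2e2m3Law.lam)
    (hj : 26880 * (j + 1) + 105 < 2 ^ (φ.manBits + 1))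
    (hsum : A + B + 26880 * j + C = 2 ^ (φ.manBits + 1) + 1) {k : ℕ} (hk : 1 ≤ k)
    (hk' : k ≤ 2 ^ φ.manBits) :
    worstRelErrMixC φ (j + 1 + k) = (k : ℚ) / (2 ^ (φ.manBits + 1) + k) :=
  gridW_firstRegime piMixC_grid (worst7P_spec φ).1 (worst7P_spec φ).2 hq (E := 14) hR
    (by norm_num) (mixC_MT hm) (by norm_num) (by norm_num) (by norm_num) (piMixC_nat hA)
    (piMixC_nat hB) (piMixC_nat hC) (piMixC_nat (A := 26880) (by decide)) piMixC_one hj hsum hk hk'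

end MixC

/-- E3M2·E2M3 INTO binary32 (`p = 24`): `W_24(n) = 0` for `n ≤ 625 = n₀`
(`26880·624 + 105 < 2^24`). [cell, gemm.tex Prop. p:fpA; C2 cross-check certs/gemm/firstregime/] -/
theorem worst7P_Binary32_eq_zero {m : ℕ} (hm : m ≤ 624) : worstRelErrMixC Format.Binary32 m = 0 := by
  obtain ⟨h1, h2, h3, h4⟩ := Binary32_hyps7
  have hT : 2 ^ (Format.Binary32.manBits + 1) = 16777216 := by rw [pow_succ, h4]; norm_num
  exact worst7P_eq_zero h1 h2 h3 (by omega)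

/-- E3M2·E2M3 INTO binary32: `W_24(625 + k) = k/(2^24 + k)` for `1 ≤ k ≤ 2^23`, attained by
`4096, 26880, 26880^{×623}, 1, 1^{×(k-1)}` (`4096 + 26880·624 + 1 = 2^24 + 1`).
[cell, gemm.tex Prop. p:fpA] -/
theorem worst7P_Binary32_firstRegime {k : ℕ} (hk : 1 ≤ k) (hk' : k ≤ 2 ^ 23) :
    worstRelErrMixC Format.Binary32 (624 + k) = (k : ℚ) / (2 ^ 24 + k) := by
  obtain ⟨h1, h2, h3, h4⟩ := Binary32_hyps7
  have hT : 2 ^ (Format.Binary32.manBits + 1) = 16777216 := by rw [pow_succ, h4]; norm_num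
  have hk'' : k ≤ 2 ^ Format.Binary32.manBits := hk'
  have h := worst7P_firstRegime h1 h2 h3 (j := 623) (A := 4096) (B := 26880) (C := 1)
    (by decide) (by decide) (by decide) (by omega) (by omega) hk hk''
  rw [show 623 + 1 + k = 624 + k by ring, show Format.Binary32.manBits + 1 = 24 from rfl] at h
  exact h

end Summit.Ventures.CertifiedArithmetic.LowPrec.Gemm
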